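import Summits.CriticalPhenomena.PercolationContinuityZ3.Theorems.PercNearOneGluingNoHeavyLowerTailKnQuestion8CoefficientwiseRootEdgePoint
import HarnessLib

/-!
# The SYMMETRIC TWO-SOURCE form of CLAIM B: `V(u,y)[g] = −T₁(x,u;y)[g]`, `T₁` is symmetric in the two sources, and its `y`-free shadow is a theorem — prim-lf-2 gen 55

Support file (`--supports stmt-CriticalPhenomena-4575`, closed), prover `prim-lf-2` (gen 55).  No definitions, no named facts, no sorries; standard axioms.
Memo `prim-lf-2/CW-TWOSOURCESYM-gen55.md` §1; part 3 of gen 53 (`…CoefficientwiseRootEdgePoint.lean`): `NO-CORE(y)[1_u,g] = 2·(A − V)` for a root edge `e = xu`.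

Setting.  Finite multigraph `ends : ι → Sym2 V`, two SOURCES `x, u`; for a colouring `s ⊆ ι` (red; `sᶜ` blue) write `K s = C_x(s)`, `U s = C_u(s)` (red clusters) and `K sᶜ`, `U sᶜ`
(blue clusters).  On the event `{u ∈ K s}` ('`x, u` red-joined') the red cluster of the SET `{x,u}` is `K s` and its blue cluster is `K sᶜ ∪ U sᶜ`.  The two-source sum
  `T₁(x,u;y)[g] := Σ_{s : u ∈ K s, ¬(y ∈ K s ∧ y ∈ K sᶜ ∪ U sᶜ)} (g(K s) − g(K sᶜ ∪ U sᶜ))`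
('given that the sources are red-joined and `y` is not in the core of `{x,u}`, the red cluster of `{x,u}` dominates its blue cluster'; the colourings with `u ∈ K s ∩ K sᶜ` cancel in pairs,
so only the red-joined / blue-separated ones matter) satisfies:
* `claimB_sum_eq_neg_twoSourceSym` — **`V(u,y)[g] = −T₁(x,u;y)[g]`** (colour swap), where `V(u,y)[g] = Σ_{t : u ∈ K tᶜ, ¬(y ∈ K t ∪ U t ∧ y ∈ K tᶜ)} (g(K t ∪ U t) − g(K tᶜ))` is the
  sum of gen 53's CLAIM B (`V ≤ 0`); hence CLAIM B ⟺ `T₁ ≥ 0`, and (`noCore_rootEdge_eq_twoSource_add`) for a root edge `e = xu`: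
  **`NO-CORE^G(y)[1_u,g] = 2·(A^{G−e}(u,y)[g] + T₁^{G−e}(x,u;y)[g])`** with THEOREM A's `A ≥ 0`; `noCore_rootAdj_nonneg_of_twoSourceSym`: `T₁^{G−e} ≥ 0 ⟹ NO-CORE^G(y)[1_u,g] ≥ 0`.
* `twoSourceSym_comm` — **`T₁(x,u;y) = T₁(u,x;y)`**: the statement is SYMMETRIC under exchanging the root with the point; consequently (`noCore_rootEdge_root_exchange`)
  `NO-CORE_x(y)[1_u,g] − NO-CORE_u(y)[1_x,g] = 2·(A_x^{G−e}(u,y)[g] − A_u^{G−e}(x,y)[g])` — exchanging the roles of the two ends of a root edge changes NO-CORE only by THEOREM-A sums.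
* `twoSourceSym_free_nonneg` — the `y`-FREE two-sided statement is a theorem: for every `F(S,L)` monotone in `S` and antitone in `L`,
  `0 ≤ Σ_{s : u ∈ K s} (F(K s, K sᶜ ∪ U sᶜ) − F(K sᶜ ∪ U sᶜ, K s))` ('Harris + swap': `{u ∈ K s}` is an up-set and `s ↦ F(K s ∪ U s, K sᶜ ∪ U sᶜ)` is monotone —
  `AntitheticProduct.sum_mul_sub_compl_nonneg`); `twoSourceSym_free_nonneg_one` is the case `F(S,L) = g(S)`.
Census of the conjecture `T₁ ≥ 0` for all monotone `g` (prim-lf-2 gen 55, code/gen55/c/ts.c; = CLAIM B of gen 53 by the first bullet): 0 exceptions on all graphs with ≤ 6 vertices (534 080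
`(G,u,y)`), on 7 vertices with ≤ 7 edges, and on W8, LOBE(3,3)…(4,4)(+leaf), K₃₃, K₃₄, K₄₄, W7, Q3, Petersen; two-sided version (all `F`): 0 exceptions on ≤ 5 vertices (kits for n = 6, 7 filed).
[cite: KozmaNitzan2024, Questions 8–9 (§5.5 p. 36) (context: the Question-8 pocket covariance programme)]
-/

namespace Summit.CriticalPhenomena.PercolationContinuityZ3.Theorems

open Finset Literature.Probability.Percolation

namespace Coefficientwise

variable {ι V : Type*} [Fintype ι] [DecidableEq ι] (ends : ι → Sym2 V) (x : V)

/-- Joined vertices have the same cluster. [cite: KozmaNitzan2024, §5.5 (context only; elementary)] -/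
theorem openCluster_eq_of_mem_openCluster {ω : Set (Sym2 V)} {a b : V} (h : b ∈ openCluster ω a) : openCluster ω b = openCluster ω a := by
  ext v
  change (openGraph ω).Reachable b v ↔ (openGraph ω).Reachable a v
  have hab : (openGraph ω).Reachable a b := h
  exact ⟨fun hbv => hab.trans hbv, fun hav => hab.symm.trans hav⟩

open Classical in
/-- **The `y`-free two-source domination (two-sided).**  For `F : Set V → Set V → ℝ` monotone in the first and antitone in the second argument,
`0 ≤ Σ_{s : u ∈ C_x(s)} (F(C_x s, C_x sᶜ ∪ C_u sᶜ) − F(C_x sᶜ ∪ C_u sᶜ, C_x s))`: given that `x` and `u` are red-joined, the red cluster of `{x,u}` exchange-dominates its blue cluster.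
(`{u ∈ C_x s}` is an up-set, `s ↦ F(C_x s ∪ C_u s, C_x sᶜ ∪ C_u sᶜ)` is monotone: `AntitheticProduct.sum_mul_sub_compl_nonneg`.)  [cite: KozmaNitzan2024, Questions 8–9 (§5.5 p. 36) (context)] -/
theorem twoSourceSym_free_nonneg (u : V) (F : Set V → Set V → ℝ)
    (hF₁ : ∀ L : Set V, Monotone (fun S : Set V => F S L)) (hF₂ : ∀ S : Set V, Antitone (fun L : Set V => F S L)) :
    0 ≤ ∑ s ∈ univ.filter (fun s : Finset ι => u ∈ openCluster (ends '' (↑s : Set ι)) x),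
      (F (openCluster (ends '' (↑s : Set ι)) x) (openCluster (ends '' (↑(sᶜ) : Set ι)) x ∪ openCluster (ends '' (↑(sᶜ) : Set ι)) u)
        - F (openCluster (ends '' (↑(sᶜ) : Set ι)) x ∪ openCluster (ends '' (↑(sᶜ) : Set ι)) u) (openCluster (ends '' (↑s : Set ι)) x)) := by
  set K : Finset ι → Set V := fun s => openCluster (ends '' (↑s : Set ι)) x with hK
  set U : Finset ι → Set V := fun s => openCluster (ends '' (↑s : Set ι)) u with hU
  change 0 ≤ ∑ s ∈ univ.filter (fun s : Finset ι => u ∈ K s), (F (K s) (K sᶜ ∪ U sᶜ) - F (K sᶜ ∪ U sᶜ) (K s))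
  have hKmono : ∀ {s t : Finset ι}, s ⊆ t → K s ⊆ K t := fun hst => openCluster_image_mono ends hst x
  have hUmono : ∀ {s t : Finset ι}, s ⊆ t → U s ⊆ U t := fun hst => openCluster_image_mono ends hst u
  set f : Finset ι → ℝ := fun s => if u ∈ K s then (1 : ℝ) else 0 with hf
  set g : Finset ι → ℝ := fun s => F (K s ∪ U s) (K sᶜ ∪ U sᶜ) with hg
  have hfm : Monotone f := by
    intro s t hst
    simp only [hf]
    by_cases hs : u ∈ K s
    · have ht : u ∈ K t := hKmono hst hs
      simp [hs, ht]
    · simp only [hs, if_false]; split_ifs <;> norm_num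
  have hgm : Monotone g := by
    intro s t hst
    simp only [hg]
    have h1 : K s ∪ U s ⊆ K t ∪ U t := Set.union_subset_union (hKmono hst) (hUmono hst)
    have h2 : K tᶜ ∪ U tᶜ ⊆ K sᶜ ∪ U sᶜ :=
      Set.union_subset_union (hKmono (compl_subset_compl.mpr hst)) (hUmono (compl_subset_compl.mpr hst))
    exact le_trans (hF₁ (K sᶜ ∪ U sᶜ) h1) (hF₂ (K t ∪ U t) h2)
  have key := AntitheticProduct.sum_mul_sub_compl_nonneg f g hfm hgm
  rw [Finset.sum_filter]
  have hrw : ∀ s : Finset ι, f s * (g s - g sᶜ) = (if u ∈ K s then (F (K s) (K sᶜ ∪ U sᶜ) - F (K sᶜ ∪ U sᶜ) (K s)) else 0) := by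
    intro s
    by_cases hs : u ∈ K s
    · have hUK : U s = K s := openCluster_eq_of_mem_openCluster hs
      simp only [hf, hg, if_pos hs, one_mul, compl_compl, hUK, Set.union_self]
    · simp only [hf, if_neg hs, zero_mul]
  rw [Finset.sum_congr rfl (fun s _ => hrw s)] at key
  exact key

open Classical in
/-- The one-function case `F(S,L) = g(S)` of `twoSourceSym_free_nonneg`: `0 ≤ Σ_{s : u ∈ C_x(s)} (g(C_x s) − g(C_x sᶜ ∪ C_u sᶜ))` for monotone `g`.
[cite: KozmaNitzan2024, Questions 8–9 (§5.5 p. 36) (context)] -/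
theorem twoSourceSym_free_nonneg_one (u : V) (g : Set V → ℝ) (hg : Monotone g) :
    0 ≤ ∑ s ∈ univ.filter (fun s : Finset ι => u ∈ openCluster (ends '' (↑s : Set ι)) x),
      (g (openCluster (ends '' (↑s : Set ι)) x) - g (openCluster (ends '' (↑(sᶜ) : Set ι)) x ∪ openCluster (ends '' (↑(sᶜ) : Set ι)) u)) :=
  twoSourceSym_free_nonneg ends x u (fun S _ => g S) (fun _ => hg) (fun _ => fun _ _ _ => le_rfl)

open Classical in
/-- **`V(u,y)[g] = −T₁(x,u;y)[g]`** (colour swap `t ↦ tᶜ`):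
`Σ_{t : u ∈ C_x tᶜ, ¬(y ∈ C_x t ∪ C_u t ∧ y ∈ C_x tᶜ)} (g(C_x t ∪ C_u t) − g(C_x tᶜ)) = −Σ_{s : u ∈ C_x s, ¬(y ∈ C_x s ∧ y ∈ C_x sᶜ ∪ C_u sᶜ)} (g(C_x s) − g(C_x sᶜ ∪ C_u sᶜ))`.
So gen 53's CLAIM B (`V ≤ 0`) is the statement `T₁ ≥ 0`. [cite: KozmaNitzan2024, Questions 8–9 (§5.5 p. 36) (context)] -/
theorem claimB_sum_eq_neg_twoSourceSym (u y : V) (g : Set V → ℝ) :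
    ∑ t ∈ univ.filter (fun t : Finset ι => u ∈ openCluster (ends '' (↑(tᶜ) : Set ι)) x ∧
        ¬ (y ∈ openCluster (ends '' (↑t : Set ι)) x ∪ openCluster (ends '' (↑t : Set ι)) u ∧ y ∈ openCluster (ends '' (↑(tᶜ) : Set ι)) x)),
      (g (openCluster (ends '' (↑t : Set ι)) x ∪ openCluster (ends '' (↑t : Set ι)) u) - g (openCluster (ends '' (↑(tᶜ) : Set ι)) x)) =
    -(∑ s ∈ univ.filter (fun s : Finset ι => u ∈ openCluster (ends '' (↑s : Set ι)) x ∧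
        ¬ (y ∈ openCluster (ends '' (↑s : Set ι)) x ∧ y ∈ openCluster (ends '' (↑(sᶜ) : Set ι)) x ∪ openCluster (ends '' (↑(sᶜ) : Set ι)) u)),
      (g (openCluster (ends '' (↑s : Set ι)) x) - g (openCluster (ends '' (↑(sᶜ) : Set ι)) x ∪ openCluster (ends '' (↑(sᶜ) : Set ι)) u))) := by
  set K : Finset ι → Set V := fun s => openCluster (ends '' (↑s : Set ι)) x with hK
  set U : Finset ι → Set V := fun s => openCluster (ends '' (↑s : Set ι)) u with hU
  change ∑ t ∈ univ.filter (fun t : Finset ι => u ∈ K tᶜ ∧ ¬ (y ∈ K t ∪ U t ∧ y ∈ K tᶜ)), (g (K t ∪ U t) - g (K tᶜ)) =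
    -(∑ s ∈ univ.filter (fun s : Finset ι => u ∈ K s ∧ ¬ (y ∈ K s ∧ y ∈ K sᶜ ∪ U sᶜ)), (g (K s) - g (K sᶜ ∪ U sᶜ)))
  rw [Finset.sum_filter, Finset.sum_filter, ← Finset.sum_neg_distrib]
  rw [← sum_compl_eq (fun t : Finset ι => if (u ∈ K tᶜ ∧ ¬ (y ∈ K t ∪ U t ∧ y ∈ K tᶜ)) then (g (K t ∪ U t) - g (K tᶜ)) else 0)]
  refine Finset.sum_congr rfl fun s _ => ?_
  simp only [compl_compl]
  by_cases h : u ∈ K s ∧ ¬ (y ∈ K s ∧ y ∈ K sᶜ ∪ U sᶜ)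
  · have h' : u ∈ K s ∧ ¬ (y ∈ K sᶜ ∪ U sᶜ ∧ y ∈ K s) := ⟨h.1, fun hc => h.2 ⟨hc.2, hc.1⟩⟩
    rw [if_pos h', if_pos h]; ring
  · have h' : ¬ (u ∈ K s ∧ ¬ (y ∈ K sᶜ ∪ U sᶜ ∧ y ∈ K s)) := fun hc => h ⟨hc.1, fun hd => hc.2 ⟨hd.2, hd.1⟩⟩
    rw [if_neg h', if_neg h]; ring

open Classical in
/-- **The two-source sum is symmetric in the two sources:** `T₁(x,u;y)[g] = T₁(u,x;y)[g]` (on `{u ∈ C_x s}` one has `C_x s = C_u s`).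
[cite: KozmaNitzan2024, Questions 8–9 (§5.5 p. 36) (context)] -/
theorem twoSourceSym_comm (u y : V) (g : Set V → ℝ) :
    ∑ s ∈ univ.filter (fun s : Finset ι => u ∈ openCluster (ends '' (↑s : Set ι)) x ∧
        ¬ (y ∈ openCluster (ends '' (↑s : Set ι)) x ∧ y ∈ openCluster (ends '' (↑(sᶜ) : Set ι)) x ∪ openCluster (ends '' (↑(sᶜ) : Set ι)) u)),
      (g (openCluster (ends '' (↑s : Set ι)) x) - g (openCluster (ends '' (↑(sᶜ) : Set ι)) x ∪ openCluster (ends '' (↑(sᶜ) : Set ι)) u)) =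
    ∑ s ∈ univ.filter (fun s : Finset ι => x ∈ openCluster (ends '' (↑s : Set ι)) u ∧
        ¬ (y ∈ openCluster (ends '' (↑s : Set ι)) u ∧ y ∈ openCluster (ends '' (↑(sᶜ) : Set ι)) u ∪ openCluster (ends '' (↑(sᶜ) : Set ι)) x)),
      (g (openCluster (ends '' (↑s : Set ι)) u) - g (openCluster (ends '' (↑(sᶜ) : Set ι)) u ∪ openCluster (ends '' (↑(sᶜ) : Set ι)) x)) := by
  set K : Finset ι → Set V := fun s => openCluster (ends '' (↑s : Set ι)) x with hK
  set U : Finset ι → Set V := fun s => openCluster (ends '' (↑s : Set ι)) u with hU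
  change ∑ s ∈ univ.filter (fun s : Finset ι => u ∈ K s ∧ ¬ (y ∈ K s ∧ y ∈ K sᶜ ∪ U sᶜ)), (g (K s) - g (K sᶜ ∪ U sᶜ)) =
    ∑ s ∈ univ.filter (fun s : Finset ι => x ∈ U s ∧ ¬ (y ∈ U s ∧ y ∈ U sᶜ ∪ K sᶜ)), (g (U s) - g (U sᶜ ∪ K sᶜ))
  rw [Finset.sum_filter, Finset.sum_filter]
  refine Finset.sum_congr rfl fun s _ => ?_
  by_cases hu : u ∈ K s
  · have hUK : U s = K s := openCluster_eq_of_mem_openCluster hu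
    have hx : x ∈ U s := by rw [hUK]; exact mem_openCluster_self _ x
    have hval : g (U s) - g (U sᶜ ∪ K sᶜ) = g (K s) - g (K sᶜ ∪ U sᶜ) := by rw [hUK, Set.union_comm (U sᶜ) (K sᶜ)]
    by_cases hc : (y ∈ K s ∧ y ∈ K sᶜ ∪ U sᶜ)
    · have hc' : (y ∈ U s ∧ y ∈ U sᶜ ∪ K sᶜ) := by rw [hUK, Set.union_comm (U sᶜ) (K sᶜ)]; exact hc
      rw [if_neg (fun h => h.2 hc), if_neg (fun h => h.2 hc')]
    · have hc' : ¬ (y ∈ U s ∧ y ∈ U sᶜ ∪ K sᶜ) := by rw [hUK, Set.union_comm (U sᶜ) (K sᶜ)]; exact hc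
      rw [if_pos ⟨hu, hc⟩, if_pos ⟨hx, hc'⟩, hval]
  · have hx : x ∉ U s := fun hx => hu (SimpleGraph.Reachable.symm hx)
    rw [if_neg (fun h => hu h.1), if_neg (fun h => hx h.1)]

section rootEdge

variable (g : Set V → ℝ) {u : V} {e : ι}

open Classical in
/-- **`NO-CORE(y)[1_u,g] = 2·(A + T₁)` on `G − e`** for a root edge `e = xu`: gen 53's `noCore_rootEdge_eq_twoSource_sub` (`= 2·(A − V)`) combined with `V = −T₁`
(`claimB_sum_eq_neg_twoSourceSym` on the sub-multigraph `G − e`).  [cite: KozmaNitzan2024, Questions 8–9 (§5.5 p. 36) (context)] -/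
theorem noCore_rootEdge_eq_twoSource_add (he : ends e = s(u, x)) (hxu : x ≠ u) (y : V) :
    ∑ s ∈ univ.filter (fun s : Finset ι => ¬ (y ∈ openCluster (ends '' (↑s : Set ι)) x ∧ y ∈ openCluster (ends '' (↑(sᶜ) : Set ι)) x)),
      ((if u ∈ openCluster (ends '' (↑s : Set ι)) x then (1 : ℝ) else 0) - (if u ∈ openCluster (ends '' (↑(sᶜ) : Set ι)) x then (1 : ℝ) else 0)) *
        (g (openCluster (ends '' (↑s : Set ι)) x) - g (openCluster (ends '' (↑(sᶜ) : Set ι)) x)) =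
    2 * (∑ t ∈ univ.filter (fun t : Finset {j : ι // j ∉ ({e} : Finset ι)} =>
          ¬ (y ∈ openCluster ((fun j : {j : ι // j ∉ ({e} : Finset ι)} => ends j.1) '' (↑t : Set {j : ι // j ∉ ({e} : Finset ι)})) x ∪
                   openCluster ((fun j : {j : ι // j ∉ ({e} : Finset ι)} => ends j.1) '' (↑t : Set {j : ι // j ∉ ({e} : Finset ι)})) u ∧
               y ∈ openCluster ((fun j : {j : ι // j ∉ ({e} : Finset ι)} => ends j.1) '' (↑(tᶜ) : Set {j : ι // j ∉ ({e} : Finset ι)})) x)),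
          (g (openCluster ((fun j : {j : ι // j ∉ ({e} : Finset ι)} => ends j.1) '' (↑t : Set {j : ι // j ∉ ({e} : Finset ι)})) x ∪
              openCluster ((fun j : {j : ι // j ∉ ({e} : Finset ι)} => ends j.1) '' (↑t : Set {j : ι // j ∉ ({e} : Finset ι)})) u) -
            g (openCluster ((fun j : {j : ι // j ∉ ({e} : Finset ι)} => ends j.1) '' (↑(tᶜ) : Set {j : ι // j ∉ ({e} : Finset ι)})) x))
        + ∑ s ∈ univ.filter (fun s : Finset {j : ι // j ∉ ({e} : Finset ι)} =>
          u ∈ openCluster ((fun j : {j : ι // j ∉ ({e} : Finset ι)} => ends j.1) '' (↑s : Set {j : ι // j ∉ ({e} : Finset ι)})) x ∧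
          ¬ (y ∈ openCluster ((fun j : {j : ι // j ∉ ({e} : Finset ι)} => ends j.1) '' (↑s : Set {j : ι // j ∉ ({e} : Finset ι)})) x ∧
               y ∈ openCluster ((fun j : {j : ι // j ∉ ({e} : Finset ι)} => ends j.1) '' (↑(sᶜ) : Set {j : ι // j ∉ ({e} : Finset ι)})) x ∪
                   openCluster ((fun j : {j : ι // j ∉ ({e} : Finset ι)} => ends j.1) '' (↑(sᶜ) : Set {j : ι // j ∉ ({e} : Finset ι)})) u)),
          (g (openCluster ((fun j : {j : ι // j ∉ ({e} : Finset ι)} => ends j.1) '' (↑s : Set {j : ι // j ∉ ({e} : Finset ι)})) x) -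
            g (openCluster ((fun j : {j : ι // j ∉ ({e} : Finset ι)} => ends j.1) '' (↑(sᶜ) : Set {j : ι // j ∉ ({e} : Finset ι)})) x ∪
              openCluster ((fun j : {j : ι // j ∉ ({e} : Finset ι)} => ends j.1) '' (↑(sᶜ) : Set {j : ι // j ∉ ({e} : Finset ι)})) u))) := by
  rw [noCore_rootEdge_eq_twoSource_sub ends x g he hxu y,
    claimB_sum_eq_neg_twoSourceSym (fun j : {j : ι // j ∉ ({e} : Finset ι)} => ends j.1) x u y g]
  ring

open Classical in
/-- **`T₁^{G−e}(x,u;y)[g] ≥ 0` implies CONJECTURE NO-CORE at the root-adjacent point `u`** (`e = xu`, any further edges at `u`, every monotone `g`): by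
`noCore_rootEdge_eq_twoSource_add` and THEOREM A (`twoSource_noCore_domination`) on `G − e`.  [cite: KozmaNitzan2024, Questions 8–9 (§5.5 p. 36) (context)] -/
theorem noCore_rootAdj_nonneg_of_twoSourceSym (he : ends e = s(u, x)) (hxu : x ≠ u) (y : V) (hg : Monotone g)
    (hT : 0 ≤ ∑ s ∈ univ.filter (fun s : Finset {j : ι // j ∉ ({e} : Finset ι)} =>
          u ∈ openCluster ((fun j : {j : ι // j ∉ ({e} : Finset ι)} => ends j.1) '' (↑s : Set {j : ι // j ∉ ({e} : Finset ι)})) x ∧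
          ¬ (y ∈ openCluster ((fun j : {j : ι // j ∉ ({e} : Finset ι)} => ends j.1) '' (↑s : Set {j : ι // j ∉ ({e} : Finset ι)})) x ∧
               y ∈ openCluster ((fun j : {j : ι // j ∉ ({e} : Finset ι)} => ends j.1) '' (↑(sᶜ) : Set {j : ι // j ∉ ({e} : Finset ι)})) x ∪
                   openCluster ((fun j : {j : ι // j ∉ ({e} : Finset ι)} => ends j.1) '' (↑(sᶜ) : Set {j : ι // j ∉ ({e} : Finset ι)})) u)),
          (g (openCluster ((fun j : {j : ι // j ∉ ({e} : Finset ι)} => ends j.1) '' (↑s : Set {j : ι // j ∉ ({e} : Finset ι)})) x) -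
            g (openCluster ((fun j : {j : ι // j ∉ ({e} : Finset ι)} => ends j.1) '' (↑(sᶜ) : Set {j : ι // j ∉ ({e} : Finset ι)})) x ∪
              openCluster ((fun j : {j : ι // j ∉ ({e} : Finset ι)} => ends j.1) '' (↑(sᶜ) : Set {j : ι // j ∉ ({e} : Finset ι)})) u))) :
    0 ≤ ∑ s ∈ univ.filter (fun s : Finset ι => ¬ (y ∈ openCluster (ends '' (↑s : Set ι)) x ∧ y ∈ openCluster (ends '' (↑(sᶜ) : Set ι)) x)),
      ((if u ∈ openCluster (ends '' (↑s : Set ι)) x then (1 : ℝ) else 0) - (if u ∈ openCluster (ends '' (↑(sᶜ) : Set ι)) x then (1 : ℝ) else 0)) *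
        (g (openCluster (ends '' (↑s : Set ι)) x) - g (openCluster (ends '' (↑(sᶜ) : Set ι)) x)) := by
  rw [noCore_rootEdge_eq_twoSource_add ends x g he hxu y]
  have hA := twoSource_noCore_domination (fun j : {j : ι // j ∉ ({e} : Finset ι)} => ends j.1) x u y g hg
  linarith

open Classical in
/-- **Root exchange along a root edge.**  For an edge `e` with ends `{u, x}` (`u ≠ x`): NO-CORE with root `x` and point `u` differs from NO-CORE with root `u` and point `x` only by
THEOREM-A sums on `G − e`:  `NO-CORE_x(y)[1_u,g] − NO-CORE_u(y)[1_x,g] = 2·(A_x^{G−e}(u,y)[g] − A_u^{G−e}(x,y)[g])`  (the two-source sums `T₁` cancel by `twoSourceSym_comm`).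
[cite: KozmaNitzan2024, Questions 8–9 (§5.5 p. 36) (context)] -/
theorem noCore_rootEdge_root_exchange (he : ends e = s(u, x)) (hxu : x ≠ u) (y : V) :
    (∑ s ∈ univ.filter (fun s : Finset ι => ¬ (y ∈ openCluster (ends '' (↑s : Set ι)) x ∧ y ∈ openCluster (ends '' (↑(sᶜ) : Set ι)) x)),
      ((if u ∈ openCluster (ends '' (↑s : Set ι)) x then (1 : ℝ) else 0) - (if u ∈ openCluster (ends '' (↑(sᶜ) : Set ι)) x then (1 : ℝ) else 0)) *
        (g (openCluster (ends '' (↑s : Set ι)) x) - g (openCluster (ends '' (↑(sᶜ) : Set ι)) x)))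
    - (∑ s ∈ univ.filter (fun s : Finset ι => ¬ (y ∈ openCluster (ends '' (↑s : Set ι)) u ∧ y ∈ openCluster (ends '' (↑(sᶜ) : Set ι)) u)),
      ((if x ∈ openCluster (ends '' (↑s : Set ι)) u then (1 : ℝ) else 0) - (if x ∈ openCluster (ends '' (↑(sᶜ) : Set ι)) u then (1 : ℝ) else 0)) *
        (g (openCluster (ends '' (↑s : Set ι)) u) - g (openCluster (ends '' (↑(sᶜ) : Set ι)) u))) =
    2 * (∑ t ∈ univ.filter (fun t : Finset {j : ι // j ∉ ({e} : Finset ι)} =>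
          ¬ (y ∈ openCluster ((fun j : {j : ι // j ∉ ({e} : Finset ι)} => ends j.1) '' (↑t : Set {j : ι // j ∉ ({e} : Finset ι)})) x ∪
                   openCluster ((fun j : {j : ι // j ∉ ({e} : Finset ι)} => ends j.1) '' (↑t : Set {j : ι // j ∉ ({e} : Finset ι)})) u ∧
               y ∈ openCluster ((fun j : {j : ι // j ∉ ({e} : Finset ι)} => ends j.1) '' (↑(tᶜ) : Set {j : ι // j ∉ ({e} : Finset ι)})) x)),
          (g (openCluster ((fun j : {j : ι // j ∉ ({e} : Finset ι)} => ends j.1) '' (↑t : Set {j : ι // j ∉ ({e} : Finset ι)})) x ∪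
              openCluster ((fun j : {j : ι // j ∉ ({e} : Finset ι)} => ends j.1) '' (↑t : Set {j : ι // j ∉ ({e} : Finset ι)})) u) -
            g (openCluster ((fun j : {j : ι // j ∉ ({e} : Finset ι)} => ends j.1) '' (↑(tᶜ) : Set {j : ι // j ∉ ({e} : Finset ι)})) x))
      - ∑ t ∈ univ.filter (fun t : Finset {j : ι // j ∉ ({e} : Finset ι)} =>
          ¬ (y ∈ openCluster ((fun j : {j : ι // j ∉ ({e} : Finset ι)} => ends j.1) '' (↑t : Set {j : ι // j ∉ ({e} : Finset ι)})) u ∪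
                   openCluster ((fun j : {j : ι // j ∉ ({e} : Finset ι)} => ends j.1) '' (↑t : Set {j : ι // j ∉ ({e} : Finset ι)})) x ∧
               y ∈ openCluster ((fun j : {j : ι // j ∉ ({e} : Finset ι)} => ends j.1) '' (↑(tᶜ) : Set {j : ι // j ∉ ({e} : Finset ι)})) u)),
          (g (openCluster ((fun j : {j : ι // j ∉ ({e} : Finset ι)} => ends j.1) '' (↑t : Set {j : ι // j ∉ ({e} : Finset ι)})) u ∪
              openCluster ((fun j : {j : ι // j ∉ ({e} : Finset ι)} => ends j.1) '' (↑t : Set {j : ι // j ∉ ({e} : Finset ι)})) x) -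
            g (openCluster ((fun j : {j : ι // j ∉ ({e} : Finset ι)} => ends j.1) '' (↑(tᶜ) : Set {j : ι // j ∉ ({e} : Finset ι)})) u))) := by
  have he' : ends e = s(x, u) := by rw [he, Sym2.eq_swap]
  rw [noCore_rootEdge_eq_twoSource_add ends x g he hxu y, noCore_rootEdge_eq_twoSource_add ends u g he' hxu.symm y,
    twoSourceSym_comm (fun j : {j : ι // j ∉ ({e} : Finset ι)} => ends j.1) x u y g]
  ring

end rootEdge

end Coefficientwise

end Summit.CriticalPhenomena.PercolationContinuityZ3.Theorems
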